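import Literature.Computability.Cryptography.ShorOrdPost
import Literature.Computability.Cryptography.ShorOrderFindingQuantum
import Literature.Computability.Complexity.StackLists
import Literature.Computability.Complexity.StackUnary
import Literature.Computability.Complexity.StackRoutines
import HarnessLib

/-!
# The modular-exponentiation machine of Kitaev's order-finding block is polynomial time

Family `PQC` (trunk `CryptoQuantFine`); the classical *programming* half of the named fact
`Kitaev1995_orderFindingFamily` of `ShorOrderFindingQuantum.lean` (Shor 1997, §3: the modular
exponentiation `x^{A} mod n` is computed in polynomial time by repeated squaring, hence —
Bennett, Lecerf — reversibly with the input kept and the garbage erased; here the plain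
polynomial-time machine, the reversible compilation being `QuantumComplexity/RevUncompute.lean`).

The machine reads the content of the input and control wires of Kitaev's circuit followed by a
constant suffix written by the circuit: `z = w ++ y ++ 0 1^ℓ`, where `w = ⟨x, n⟩` is the instance
(`|w| = ℓ`), and `y` the `4 · (2ℓ+1) · 2B` control bits, trial by trial, level by level
(`B = blockSize ℓ = 6144 (2ℓ+1)`). It outputs the coded list of the four residues
`x^{A_t(y)} mod n`, `A_t(y) = ∑_{l} 2^l · #{ones of y in block (t, l)}`, computed as
`∏_l (x^{2^l})^{#ones}` by one modular multiplication per set control bit and one squaring per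
level (CLRS, §31.6; Shor 1997, §3, p. 9: "modular exponentiation … by repeated squaring"):

* `ModExpBlock.prog` — the structured stack program (`StackPrograms.lean`) over the arithmetic
  bank of `StackArith.lean`/`StackModArith.lean` (`modMul`) and the string routines of
  `StackStrings.lean` (`unpairW`, flags), `StackUnary.lean` (unary counters `ℓ, 2ℓ+1, 2B`),
  `StackLists.lean` (`emit`);
* `ModExpBlock.blockFn` — its function, in closed form: `parsed`/`valid` (the suffix `0 1^ℓ`
  read from the right, the instance unpaired and checked) and the loop models `bitLoop`,
  `levelLoop`, `trials`;
* `ModExpBlock.runs_prog`, `ModExpBlock.blockFn_mem_FP` — simulation within the polynomial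
  `costPoly`, hence `blockFn ∈ FP` (`Com.mem_FP`);
* `ModExpBlock.blockFn_wellFormed` — **on a well-formed input the output is
  `encList [encodeNat (x^{A_0} mod n), …, encodeNat (x^{A_3} mod n)]`**, with
  `A_t = levelExp (blocks of trial t)` (`levelExp`, `trial_eq`, `trials_eq`).

## References

* P. W. Shor, *Polynomial-time algorithms for prime factorization and discrete logarithms on a
  quantum computer*, SIAM J. Comput. 26 (1997) 1484–1509, §3 (pp. 8–10 of arXiv v2).
* T. H. Cormen, C. E. Leiserson, R. L. Rivest, C. Stein, *Introduction to Algorithms*, MIT Press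
  (3rd ed. 2009), §31.6 (MODULAR-EXPONENTIATION by repeated squaring).
* S. Arora, B. Barak, *Computational Complexity: A Modern Approach*, CUP 2009, §1.3
  (robustness of polynomial time).
-/

noncomputable section

namespace Literature.Computability.Cryptography

open _root_.Computability Complexity Complexity.Com Complexity.AReg OrdPost

namespace ModExpBlock

/-! ### The loop models -/

/-- The bit loop of one level: for each of `m` pops of the control stream `S`, multiply `r` by
`p` modulo `n` if the popped bit is `1` (an exhausted stream pops nothing). Returns the new `r`
and the rest of the stream. [cite: Shor1997, §3 (p.9, repeated squaring)] -/
def bitLoop (n p : ℕ) : ℕ → ℕ → List Bool → ℕ × List Bool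
  | r, 0, S => (r, S)
  | r, _ + 1, [] => (r, [])
  | r, m + 1, b :: S => bitLoop n p (if b then r * p % n else r) m S

/-- The level loop of one trial: `k` levels of `m` control bits each; after each level the
current power `p = x^{2^l} mod n` is squared. Returns `(p, r, rest of the stream)`.
[cite: Shor1997, §3 (p.9, repeated squaring)] -/
def levelLoop (n m : ℕ) : ℕ → ℕ → ℕ → List Bool → ℕ × ℕ × List Bool
  | p, r, 0, S => (p, r, S)
  | p, r, k + 1, S => levelLoop n m (p * p % n) (bitLoop n p r m S).1 k (bitLoop n p r m S).2

/-- The result of one trial: from `p = x mod n`, `r = 1`. [folklore] -/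
def trial (x n k m : ℕ) (S : List Bool) : ℕ × List Bool :=
  ((levelLoop n m (x % n) 1 k S).2.1, (levelLoop n m (x % n) 1 k S).2.2)

/-- The residues of `j` consecutive trials on the stream `S`. [folklore] -/
def trials (x n k m : ℕ) : ℕ → List Bool → List ℕ
  | 0, _ => []
  | j + 1, S => (trial x n k m S).1 :: trials x n k m j (trial x n k m S).2

/-! ### Registers and register files -/

/-- The outer registers of the program (next to the arithmetic bank `AReg`). [folklore] -/
inductive K where
  | inp | S | S2 | L | LV | BB | LC | BC | W | W2 | A | T | MODE | PEND | F1
  | X0 | R | P | M | T1 | T2 | T3 | OUT | RES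
  deriving DecidableEq, Fintype

/-- All registers. [folklore] -/
abbrev RR := K ⊕ AReg

/-- An outer register file given by an association list (`OrdPost.mk` for this register type).
[folklore] -/
def mk (l : List (K × List Bool)) : Regs K := fun r => (l.lookup r).getD []

/-- Writing into an association-list file prepends. [folklore] -/
theorem update_mk (l : List (K × List Bool)) (k : K) (v : List Bool) :
    Function.update (mk l) k v = mk ((k, v) :: l) := by
  funext r
  by_cases h : r = k
  · subst h; simp [mk, List.lookup]
  · rw [Function.update_of_ne h]
    have hb : (r == k) = false := beq_false_of_ne h
    simp [mk, List.lookup, hb]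

/-- Reading the empty file. [folklore] -/
@[simp] theorem mk_nil (r : K) : mk [] r = [] := rfl

/-- Reading past one entry. [folklore] -/
theorem mk_cons (k : K) (v : List Bool) (l : List (K × List Bool)) (r : K) :
    mk ((k, v) :: l) r = if r = k then v else mk l r := by
  by_cases h : r = k
  · subst h; simp [mk, List.lookup]
  · have hb : (r == k) = false := beq_false_of_ne h
    simp [mk, List.lookup, hb, h]

/-- The empty bank. [folklore] -/
abbrev bank0 : Regs AReg := file [] [] [] [] [] [] [] []

/-- The initial register file of the program. [folklore] -/
theorem init_eq (z : List Bool) :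
    Regs.init (Sum.inl K.inp : RR) z = Sum.elim (mk [(K.inp, z)]) bank0 := by
  funext r
  rcases r with r | r
  · by_cases h : r = K.inp
    · subst h; rfl
    · have hb : (r == K.inp) = false := beq_false_of_ne h
      simp [Regs.init, h, mk, List.lookup, hb]
  · cases r <;> rfl

/-- Outer register `k`. [folklore] -/
abbrev o (k : K) : RR := Sum.inl k

/-! ### The program -/

/-- Reading the unary suffix from the right: count the `1`s on top of `S` (the reversed input)
into `L`; at the first `0` pour the rest back, restoring the reading order, into `S2`.
[folklore] -/
def readL : Com RR := loop (o .S) (push (o .L) true) (pour (o .S) (o .S2))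

/-- `BB := 1^{12288 · |LC|}` (the block length `2 · blockSize ℓ = 12288 (2ℓ+1)`). [folklore] -/
def mkBB : Com RR := loop (o .LC) (pushK (o .BB) 12288) (pushK (o .BB) 12288)

/-- **The parser**: reverse the input, read `ℓ`, compute `2ℓ+1` and `2B`, cut the instance `w`
(the first `ℓ` bits), unpair it into `x` (on `A`, most significant bit first) and `n` (on `T`,
most significant bit first), and set `MODE` to the validity flag (well-paired, `n` canonical with
at least two bits). [folklore] -/
def parse : Com RR :=
  pour (o .inp) (o .S) ;;
  (readL ;;
  (addReg (o .L) (o .LV) (o .T1) ;; (addReg (o .L) (o .LV) (o .T1) ;; (push (o .LV) true ;;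
  (copy (o .LV) (o .LC) (o .T1) (o .T2) ;; (mkBB ;;
  (takeN (o .L) (o .S2) (o .W) ;; (pour (o .W) (o .W2) ;;
  (unpairW (o .W2) (o .A) (o .T) (o .MODE) (o .PEND) ;;
  (peekCanon (o .T) (o .F1) ;; (andFlag (o .MODE) (o .F1) ;;
  (peekTwo (o .T) (o .F1) ;; andFlag (o .MODE) (o .F1)))))))))))))

/-- **Modular multiplication of registers** `c := a · b mod n` (`a`, `b` reduced numerals, least
significant bit first; the bank holds `n` in `y`): copy `a` onto `z`, copy `b` reversed onto the
multiplier register `M`, `modMul`, move the product out of `x`, clear `z`. [cite: CLRS2009, §31.6] -/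
def mulR (a b c : K) : Com RR :=
  copy (o a) (Sum.inr .z) (o .T1) (o .T2) ;; (copy (o b) (o .T3) (o .T1) (o .T2) ;;
  (pour (o .T3) (o .M) ;; (modMul K.M ;; (clear (o c) ;; (move (Sum.inr .x) (o c) (o .T1) ;;
  clear (Sum.inr .z))))))

/-- One control bit: pop it; on `1` multiply `R` by `P`. [cite: Shor1997, §3 p.9] -/
def bitC : Com RR := pop (o .S2) (mulR .R .P .R) skip skip

/-- One level: `2B` control bits, then square `P`. [cite: Shor1997, §3 p.9] -/
def levelC : Com RR := copy (o .BB) (o .BC) (o .T1) (o .T2) ;; (loop (o .BC) bitC bitC ;; mulR .P .P .P)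

/-- One trial: `R := 1`, `P := x mod n`, all levels, emit `R`. [folklore] -/
def trialC : Com RR :=
  clear (o .R) ;; (push (o .R) true ;; (clear (o .P) ;; (copy (o .X0) (o .P) (o .T1) (o .T2) ;;
  (copy (o .LV) (o .LC) (o .T1) (o .T2) ;; (loop (o .LC) levelC levelC ;; emit (o .R) (o .OUT))))))

/-- The setup of the kernel (valid instances): modulus into the bank, base reduced modulo `n`
into `X0` (`modMul` by the multiplier `x` with multiplicand `1`). [folklore] -/
def setupC : Com RR :=
  pour (o .T) (Sum.inr .y) ;; (push (Sum.inr .z) true ;; (modMul K.A ;;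
  (move (Sum.inr .x) (o .X0) (o .T1) ;; clear (Sum.inr .z))))

/-- The kernel (valid instances): setup, four trials, output. [folklore] -/
def kernel : Com RR :=
  setupC ;; (trialC ;; (trialC ;; (trialC ;; (trialC ;; pour (o .OUT) (o .RES)))))

/-- **The whole program.** [folklore] -/
def prog : Com RR := parse ;; ifFlag (o .MODE) kernel skip

/-! ### What the parser computes -/

/-- The length `ℓ` read off the unary suffix: the number of trailing `1`s of the input.
[folklore] -/
def ell (z : List Bool) : ℕ := (z.reverse.takeWhile fun b => b).length

/-- The input without its suffix `0 1^ℓ` (empty if the input has no `0`). [folklore] -/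
def pre (z : List Bool) : List Bool := ((z.reverse.dropWhile fun b => b).tail).reverse

/-- The instance part: the first `ℓ` bits of `pre`. [folklore] -/
def wq (z : List Bool) : List Bool := (pre z).take (ell z)

/-- The control stream: the rest of `pre`. [folklore] -/
def ys (z : List Bool) : List Bool := (pre z).drop (ell z)

/-- The first component of the instance (numeral of `x`). [folklore] -/
def fstq (z : List Bool) : List Bool := (boolUnpair (wq z)).1

/-- The second component of the instance (numeral of `n`). [folklore] -/
def sndq (z : List Bool) : List Bool := (boolUnpair (wq z)).2

/-- The number of levels `2ℓ + 1`. [folklore] -/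
def lv (z : List Bool) : ℕ := 2 * ell z + 1

/-- The number of control bits per level, `2 · blockSize ℓ = 12288 (2ℓ+1)`. [folklore] -/
def bb (z : List Bool) : ℕ := 12288 * lv z

/-- The validity flag: the instance is a pair whose second component is a canonical numeral
of value `> 1`. [folklore] -/
def valid (z : List Bool) : Bool :=
  (wellPaired (wq z) && canonTop (sndq z).reverse) && decide (2 ≤ (sndq z).length)

/-- The reversed input splits into its leading ones and the rest. [folklore] -/
theorem reverse_eq_ones_append (z : List Bool) :
    z.reverse = ones (ell z) ++ z.reverse.dropWhile (fun b => b) := by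
  conv_lhs => rw [← List.takeWhile_append_dropWhile (p := fun b => b) (l := z.reverse)]
  congr 1
  rw [ell]
  refine List.eq_replicate_iff.2 ⟨rfl, fun b hb => ?_⟩
  simpa using List.mem_takeWhile_imp hb

/-- The rest after the leading ones is empty or starts with `0`. [folklore] -/
theorem dropWhile_shape (z : List Bool) :
    z.reverse.dropWhile (fun b => b) = [] ∨
      ∃ r, z.reverse.dropWhile (fun b => b) = false :: r := by
  rcases h : z.reverse.dropWhile (fun b => b) with _ | ⟨b, r⟩
  · exact Or.inl rfl
  · have hb := List.head_dropWhile_not (p := fun b => b) (l := z.reverse) (by rw [h]; simp)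
    rw [List.head_eq_iff_head?_eq_some] at hb
    simp only [h, List.head?_cons, Option.some.injEq] at hb
    right
    refine ⟨r, ?_⟩
    have : b = false := by simpa using hb
    rw [this]

/-- Sizes: `ℓ ≤ |z|`. [folklore] -/
theorem ell_le (z : List Bool) : ell z ≤ z.length := by
  rw [ell]
  exact (List.takeWhile_prefix _).length_le.trans (by simp)

/-- Sizes: `|pre z| + ℓ + 1 ≤ |z|` unless `pre z` is empty. [folklore] -/
theorem length_pre_le (z : List Bool) : (pre z).length + ell z ≤ z.length := by
  have h := congrArg List.length (reverse_eq_ones_append z)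
  simp only [List.length_reverse, List.length_append, List.length_replicate] at h
  rw [pre, List.length_reverse, List.length_tail]
  omega

/-- On a well-formed input the suffix is read correctly. [folklore] -/
theorem ell_wf (u : List Bool) (ℓ : ℕ) : ell (u ++ false :: ones ℓ) = ℓ := by
  rw [ell, List.reverse_append, List.reverse_cons, List.reverse_replicate, List.append_assoc,
    List.singleton_append, List.takeWhile_append_of_pos (by simp)]
  simp

/-- On a well-formed input the body is read correctly. [folklore] -/
theorem pre_wf (u : List Bool) (ℓ : ℕ) : pre (u ++ false :: ones ℓ) = u := by
  rw [pre, List.reverse_append, List.reverse_cons, List.reverse_replicate, List.append_assoc,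
    List.singleton_append, List.dropWhile_append_of_pos (by simp)]
  simp

/-! ### Simulation of the parser -/

/-- **Simulation of `readL`.** From `S = 1^a ++ rest` (`rest` empty or starting with `0`): `L`
gains `1^a`, `S` is emptied, and `S2` gains the reversal of the tail of `rest`. [folklore] -/
theorem runs_readL (a : ℕ) (rest : List Bool) (hrest : rest = [] ∨ ∃ r, rest = false :: r) :
    ∀ F : Regs RR, F (o .S) = ones a ++ rest →
      Runs readL F (Function.update (Function.update (Function.update F (o .S) []) (o .L)
        (ones a ++ F (o .L))) (o .S2) (rest.tail.reverse ++ F (o .S2))) (3 * (a + rest.length) + 2) := by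
  induction a with
  | zero =>
    intro F hF
    rcases hrest with rfl | ⟨r, rfl⟩
    · have hF' : F (o .S) = [] := by simpa using hF
      refine (Runs.loop_nil _ _ hF').of_eq ?_ (by simp)
      funext i
      by_cases h1 : i = o .S2
      · subst h1; simp
      · rw [Function.update_of_ne h1]
        by_cases h2 : i = o .L
        · subst h2; simp
        · rw [Function.update_of_ne h2]
          by_cases h3 : i = o .S
          · subst h3; simp [hF']
          · rw [Function.update_of_ne h3]
    · have hk : F (o .S) = false :: r := by simpa using hF
      have hp := runs_pour (a := o .S) (b := o .S2) (by decide) (Function.update F (o .S) r)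
      refine (Runs.loop_false hk hp (Runs.loop_nil _ _ (by simp))).of_eq ?_ ?_
      · funext i
        simp only [List.tail_cons, ones, List.replicate_zero, List.nil_append]
        by_cases h1 : i = o .S2
        · subst h1; simp
        · rw [Function.update_of_ne h1, Function.update_of_ne h1]
          by_cases h2 : i = o .L
          · subst h2; simp
          · rw [Function.update_of_ne h2]
            by_cases h3 : i = o .S
            · subst h3; simp
            · simp [h3]
      · simp; omega
  | succ a ih =>
    intro F hF
    have hk : F (o .S) = true :: (ones a ++ rest) := by rw [hF, ones_succ]; rfl
    have h1 : Runs (Com.push (o .L) true) (Function.update F (o .S) (ones a ++ rest))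
        (Function.update (Function.update F (o .S) (ones a ++ rest)) (o .L) (true :: F (o .L))) 1 :=
      Runs.push' (by simp)
    have h2 := ih (Function.update (Function.update F (o .S) (ones a ++ rest)) (o .L) (true :: F (o .L)))
      (by simp)
    refine (Runs.loop_true hk h1 h2).of_eq ?_ ?_
    · funext i
      by_cases h1 : i = o .S2
      · subst h1; simp
      · rw [Function.update_of_ne h1, Function.update_of_ne h1]
        by_cases h2 : i = o .L
        · subst h2
          simp only [Function.update_self, ones_succ]
          simp [ones]
        · rw [Function.update_of_ne h2, Function.update_of_ne h2]
          by_cases h3 : i = o .S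
          · subst h3; simp
          · simp [h2, h3]
    · simp; omega

/-- **Simulation of `mkBB`**: `BB` gains `12288` units per bit of `LC`, `LC` is emptied.
[folklore] -/
theorem runs_mkBB : ∀ (v : List Bool) (F : Regs RR), F (o .LC) = v →
    Runs mkBB F (Function.update (Function.update F (o .LC) []) (o .BB) (ones (12288 * v.length) ++ F (o .BB)))
      (12290 * v.length + 1)
  | [], F, hF => by
    refine (Runs.loop_nil _ _ hF).of_eq ?_ (by simp)
    funext i
    by_cases hi : i = o .BB
    · subst hi; simp
    · rw [Function.update_of_ne hi]
      by_cases hj : i = o .LC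
      · subst hj; simp [hF]
      · rw [Function.update_of_ne hj]
  | b :: v, F, hF => by
    have h1 : ∀ b' : Bool, Runs (bif b' then pushK (o K.BB) 12288 else pushK (o K.BB) 12288)
        (Function.update F (o .LC) v)
        (Function.update (Function.update F (o .LC) v) (o .BB) (ones 12288 ++ F (o .BB))) 12288 := by
      intro b'
      cases b' <;> simpa using runs_pushK (o K.BB) 12288 (Function.update F (o .LC) v)
    have h2 := runs_mkBB v (Function.update (Function.update F (o .LC) v) (o .BB) (ones 12288 ++ F (o .BB)))
      (by simp)
    have hfin : Function.update (Function.update (Function.update (Function.update F (o K.LC) v) (o K.BB)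
        (ones 12288 ++ F (o K.BB))) (o K.LC) []) (o K.BB) (ones (12288 * v.length) ++
          Function.update (Function.update F (o K.LC) v) (o K.BB) (ones 12288 ++ F (o K.BB)) (o K.BB)) =
        Function.update (Function.update F (o K.LC) []) (o K.BB) (ones (12288 * (b :: v).length) ++ F (o K.BB)) := by
      funext i
      by_cases hi : i = o .BB
      · subst hi
        simp only [Function.update_self, List.length_cons, ← List.append_assoc, ones_append, Nat.mul_succ]
      · rw [Function.update_of_ne hi, Function.update_of_ne hi]
        by_cases hj : i = o .LC
        · subst hj; simp
        · simp [hi, hj]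
    rw [← hfin]
    cases b
    · exact (Runs.loop_false hF (h1 false) h2).of_eq rfl (by simp; ring_nf; omega)
    · exact (Runs.loop_true hF (h1 true) h2).of_eq rfl (by simp; ring_nf; omega)

/-! The successive outer register files of `parse` (association lists, newest writes first). -/

/-- Stage 0: the input. [folklore] -/
def st0 (z : List Bool) : List (K × List Bool) := [(.inp, z)]
/-- Stage 1: reversed input on `S`. [folklore] -/
def st1 (z : List Bool) : List (K × List Bool) := (.S, z.reverse) :: (.inp, []) :: st0 z
/-- Stage 2: `ℓ` read, body on `S2`. [folklore] -/
def st2 (z : List Bool) : List (K × List Bool) := (.S2, pre z) :: (.L, ones (ell z)) :: (.S, []) :: st1 z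
/-- Stage 3. [folklore] -/
def st3 (z : List Bool) : List (K × List Bool) := (.LV, ones (ell z)) :: (.L, ones (ell z)) :: st2 z
/-- Stage 4. [folklore] -/
def st4 (z : List Bool) : List (K × List Bool) := (.LV, ones (ell z + ell z)) :: (.L, ones (ell z)) :: st3 z
/-- Stage 5: `LV = 1^{2ℓ+1}`. [folklore] -/
def st5 (z : List Bool) : List (K × List Bool) := (.LV, ones (lv z)) :: st4 z
/-- Stage 6. [folklore] -/
def st6 (z : List Bool) : List (K × List Bool) := (.LC, ones (lv z)) :: st5 z
/-- Stage 7: `BB = 1^{2B}`. [folklore] -/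
def st7 (z : List Bool) : List (K × List Bool) := (.BB, ones (bb z)) :: (.LC, []) :: st6 z
/-- Stage 8: the instance cut off. [folklore] -/
def st8 (z : List Bool) : List (K × List Bool) := (.W, (wq z).reverse) :: (.S2, ys z) :: (.L, []) :: st7 z
/-- Stage 9. [folklore] -/
def st9 (z : List Bool) : List (K × List Bool) := (.W2, wq z) :: (.W, []) :: st8 z
/-- Stage 10: the instance unpaired. [folklore] -/
def st10 (z : List Bool) : List (K × List Bool) :=
  (.PEND, []) :: (.MODE, flag (wellPaired (wq z))) :: (.T, (sndq z).reverse) :: (.A, (fstq z).reverse) :: (.W2, []) :: st9 z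
/-- Stage 11. [folklore] -/
def st11 (z : List Bool) : List (K × List Bool) := (.F1, flag (canonTop (sndq z).reverse)) :: st10 z
/-- Stage 12. [folklore] -/
def st12 (z : List Bool) : List (K × List Bool) := (.MODE, flag (wellPaired (wq z) && canonTop (sndq z).reverse)) :: st11 z
/-- Stage 13. [folklore] -/
def st13 (z : List Bool) : List (K × List Bool) := (.F1, flag (decide (2 ≤ (sndq z).length))) :: st12 z
/-- Stage 14: the validity flag. [folklore] -/
def st14 (z : List Bool) : List (K × List Bool) := (.MODE, flag (valid z)) :: st13 z

/-- The outer register file after `parse`. [folklore] -/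
abbrev parsed (z : List Bool) : List (K × List Bool) := st14 z

attribute [local simp] st0 st1 st2 st3 st4 st5 st6 st7 st8 st9 st10 st11 st12 st13 st14 update_mk mk_cons

/-- The cost of the parser. [folklore] -/
def parseCost (s : ℕ) : ℕ := 12290 * (2 * s + 1) + 100 * s + 100

/-- **Simulation of `parse`.** [folklore] -/
theorem runs_parse (z : List Bool) :
    Runs parse (Sum.elim (mk (st0 z)) bank0) (Sum.elim (mk (parsed z)) bank0) (parseCost z.length) := by
  have hℓ := ell_le z
  have hpre := length_pre_le z
  have hwq : (wq z).length ≤ (pre z).length := (List.take_prefix _ _).length_le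
  have hsnd : (sndq z).length ≤ (wq z).length := length_boolUnpair_snd_le _
  have h1 : Runs _ (Sum.elim (mk (st0 z)) bank0 : Regs RR) (Sum.elim (mk (st1 z)) bank0) _ :=
    (runs_pour (a := o .inp) (b := o .S) (by decide) (Sum.elim (mk (st0 z)) bank0)).of_eq
      (by simp [-Sum.elim_update_left, -Sum.elim_update_right]) le_rfl
  have h2 : Runs _ (Sum.elim (mk (st1 z)) bank0 : Regs RR) (Sum.elim (mk (st2 z)) bank0) _ :=
    (runs_readL (ell z) _ (dropWhile_shape z) (Sum.elim (mk (st1 z)) bank0)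
      (by simp only [Sum.elim_inl, mk_cons, st1, if_true]; exact reverse_eq_ones_append z)).of_eq
      (by simp [-Sum.elim_update_left, -Sum.elim_update_right, pre]) le_rfl
  have h3 : Runs _ (Sum.elim (mk (st2 z)) bank0 : Regs RR) (Sum.elim (mk (st3 z)) bank0) _ :=
    (runs_addReg (p := o .L) (v := o .LV) (t := o .T1) (by decide) (by decide) (by decide)
      (Sum.elim (mk (st2 z)) bank0) rfl).of_eq
      (by simp [-Sum.elim_update_left, -Sum.elim_update_right]) le_rfl
  have h4 : Runs _ (Sum.elim (mk (st3 z)) bank0 : Regs RR) (Sum.elim (mk (st4 z)) bank0) _ :=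
    (runs_addReg (p := o .L) (v := o .LV) (t := o .T1) (by decide) (by decide) (by decide)
      (Sum.elim (mk (st3 z)) bank0) rfl).of_eq
      (by simp [-Sum.elim_update_left, -Sum.elim_update_right]) le_rfl
  have h5 : Runs _ (Sum.elim (mk (st4 z)) bank0 : Regs RR) (Sum.elim (mk (st5 z)) bank0) _ :=
    (Runs.push (o .LV) true (Sum.elim (mk (st4 z)) bank0)).of_eq
      (by simp [-Sum.elim_update_left, -Sum.elim_update_right, lv, ← ones_succ]; ring_nf) le_rfl
  have h6 : Runs _ (Sum.elim (mk (st5 z)) bank0 : Regs RR) (Sum.elim (mk (st6 z)) bank0) _ :=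
    (runs_copy (a := o .LV) (b := o .LC) (t := o .T1) (u := o .T2) (by decide) (by decide) (by decide)
      (by decide) (by decide) (by decide) (Sum.elim (mk (st5 z)) bank0) rfl rfl).of_eq
      (by simp [-Sum.elim_update_left, -Sum.elim_update_right]) le_rfl
  have h7 : Runs _ (Sum.elim (mk (st6 z)) bank0 : Regs RR) (Sum.elim (mk (st7 z)) bank0) _ :=
    (runs_mkBB _ (Sum.elim (mk (st6 z)) bank0) rfl).of_eq
      (by simp [-Sum.elim_update_left, -Sum.elim_update_right, bb]) le_rfl
  have h8 : Runs _ (Sum.elim (mk (st7 z)) bank0 : Regs RR) (Sum.elim (mk (st8 z)) bank0) _ :=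
    (runs_takeN (q := o .L) (s := o .S2) (d := o .W) (by decide) (by decide) (by decide) _
      (Sum.elim (mk (st7 z)) bank0) rfl).of_eq
      (by simp [-Sum.elim_update_left, -Sum.elim_update_right, wq, ys]) le_rfl
  have h9 : Runs _ (Sum.elim (mk (st8 z)) bank0 : Regs RR) (Sum.elim (mk (st9 z)) bank0) _ :=
    (runs_pour (a := o .W) (b := o .W2) (by decide) (Sum.elim (mk (st8 z)) bank0)).of_eq
      (by simp [-Sum.elim_update_left, -Sum.elim_update_right]) le_rfl
  have h10 : Runs _ (Sum.elim (mk (st9 z)) bank0 : Regs RR) (Sum.elim (mk (st10 z)) bank0) _ :=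
    (runs_unpairW (k := o .W2) (a := o .A) (t := o .T) (M := o .MODE) (P := o .PEND)
      (by decide) (Sum.elim (mk (st9 z)) bank0) rfl rfl).of_eq
      (by simp [-Sum.elim_update_left, -Sum.elim_update_right, fstq, sndq]) le_rfl
  have h11 : Runs _ (Sum.elim (mk (st10 z)) bank0 : Regs RR) (Sum.elim (mk (st11 z)) bank0) _ :=
    (runs_peekCanon (a := o .T) (F := o .F1) (by decide) (Sum.elim (mk (st10 z)) bank0)
      (by exact Nat.zero_le 1)).of_eq
      (by simp [-Sum.elim_update_left, -Sum.elim_update_right]) le_rfl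
  have h12 : Runs _ (Sum.elim (mk (st11 z)) bank0 : Regs RR) (Sum.elim (mk (st12 z)) bank0) _ :=
    (runs_andFlag (o .MODE) (o .F1) (Sum.elim (mk (st11 z)) bank0) _ _ rfl rfl).of_eq
      (by simp [-Sum.elim_update_left, -Sum.elim_update_right]) le_rfl
  have h13 : Runs _ (Sum.elim (mk (st12 z)) bank0 : Regs RR) (Sum.elim (mk (st13 z)) bank0) _ :=
    (runs_peekTwo (a := o .T) (F := o .F1) (by decide) (Sum.elim (mk (st12 z)) bank0)
      (length_flag_le _)).of_eq
      (by simp [-Sum.elim_update_left, -Sum.elim_update_right]) le_rfl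
  have h14 : Runs _ (Sum.elim (mk (st13 z)) bank0 : Regs RR) (Sum.elim (mk (st14 z)) bank0) _ :=
    (runs_andFlag (o .MODE) (o .F1) (Sum.elim (mk (st13 z)) bank0) _ _ rfl rfl).of_eq
      (by simp [-Sum.elim_update_left, -Sum.elim_update_right, valid]) le_rfl
  refine (h1.seq (h2.seq (h3.seq (h4.seq (h5.seq (h6.seq (h7.seq (h8.seq (h9.seq (h10.seq (h11.seq
    (h12.seq (h13.seq h14))))))))))))).of_eq rfl ?_
  have : (z.reverse.dropWhile fun b => b).length ≤ z.length :=
    (List.dropWhile_suffix _).length_le.trans (by simp)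
  simp [parseCost, lv]
  omega

/-! ### Numerals produced by the bank -/

/-- `encodeNat` numerals are normal (empty or ending in `1`). [folklore] -/
theorem isNormal_encodeNat (v : ℕ) : IsNormal (encodeNat v) := by
  rcases isCanonicalNum_encodeNat v with h | h
  · exact Or.inl h
  · right
    refine ⟨(encodeNat v).dropLast, ?_⟩
    rw [List.getLast?_eq_some_iff] at h
    obtain ⟨ys, hys⟩ := h
    rw [hys]; simp

/-- **`modMul` from zero yields the canonical numeral of the product.** [folklore] -/
theorem modMulRes_nil_eq (bs n xx : List Bool) (hn : 0 < bitsToNat n) (hx : bitsToNat xx < bitsToNat n) :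
    modMulRes bs [] n xx = encodeNat (bitsToNat xx * bitsToNat bs.reverse % bitsToNat n) :=
  eq_of_bitsToNat_eq_of_canonical _ _ (isNormal_modMulRes _ _ _ _ (Or.inl rfl)) (isNormal_encodeNat _)
    (by rw [bitsToNat_modMulRes_nil bs n xx hn hx, bitsToNat_encodeNat])

/-- Lengths of `modMul` results. [folklore] -/
theorem length_modMulRes_nil_le (bs n xx : List Bool) (hn : 0 < bitsToNat n) (hx : bitsToNat xx < bitsToNat n) :
    (modMulRes bs [] n xx).length ≤ n.length :=
  (modMulRes_lt_and_length bs [] n xx (by simpa using hn) hx (Nat.zero_le _)).2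

/-! ### The kernel's register files -/

/-- The changing outer registers during the kernel. [folklore] -/
structure KSt where
  /-- unread control bits -/
  S2 : List Bool
  /-- current residue `r` -/
  R : List Bool
  /-- current power `p` -/
  P : List Bool
  /-- level counter -/
  LC : List Bool
  /-- bit counter -/
  BC : List Bool
  /-- reversed coded output list -/
  OUT : List Bool

/-- The outer register file of a kernel state (`X0v`: the reduced base, constant). [folklore] -/
def kout (z X0v : List Bool) (st : KSt) : K → List Bool
  | .S2 => st.S2 | .R => st.R | .P => st.P | .LC => st.LC | .BC => st.BC | .OUT => st.OUT
  | .X0 => X0v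
  | .A => [] | .T => [] | .M => [] | .T1 => [] | .T2 => [] | .T3 => [] | .RES => []
  | k => mk (parsed z) k

/-- The whole register file of a kernel state: the bank holds the modulus in `y`, all other
bank registers are empty between the routines. [folklore] -/
def kfile (z X0v : List Bool) (st : KSt) : Regs RR := Sum.elim (kout z X0v st) (file [] (sndq z) [] [] [] [] [] [])

section KFile

variable (z X0v : List Bool) (st : KSt) (v : List Bool)

/-- Reading `S2` of a kernel file. [folklore] -/
@[simp] theorem kout_S2 : kout z X0v st .S2 = st.S2 := rfl
/-- Reading `R` of a kernel file. [folklore] -/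
@[simp] theorem kout_R : kout z X0v st .R = st.R := rfl
/-- Reading `P` of a kernel file. [folklore] -/
@[simp] theorem kout_P : kout z X0v st .P = st.P := rfl
/-- Reading `LC` of a kernel file. [folklore] -/
@[simp] theorem kout_LC : kout z X0v st .LC = st.LC := rfl
/-- Reading `BC` of a kernel file. [folklore] -/
@[simp] theorem kout_BC : kout z X0v st .BC = st.BC := rfl
/-- Reading `OUT` of a kernel file. [folklore] -/
@[simp] theorem kout_OUT : kout z X0v st .OUT = st.OUT := rfl
/-- Reading `X0` of a kernel file. [folklore] -/
@[simp] theorem kout_X0 : kout z X0v st .X0 = X0v := rfl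
/-- Reading `A` of a kernel file. [folklore] -/
@[simp] theorem kout_A : kout z X0v st .A = [] := rfl
/-- Reading `T` of a kernel file. [folklore] -/
@[simp] theorem kout_T : kout z X0v st .T = [] := rfl
/-- Reading `M` of a kernel file. [folklore] -/
@[simp] theorem kout_M : kout z X0v st .M = [] := rfl
/-- Reading `T1` of a kernel file. [folklore] -/
@[simp] theorem kout_T1 : kout z X0v st .T1 = [] := rfl
/-- Reading `T2` of a kernel file. [folklore] -/
@[simp] theorem kout_T2 : kout z X0v st .T2 = [] := rfl
/-- Reading `T3` of a kernel file. [folklore] -/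
@[simp] theorem kout_T3 : kout z X0v st .T3 = [] := rfl
/-- Reading `RES` of a kernel file. [folklore] -/
@[simp] theorem kout_RES : kout z X0v st .RES = [] := rfl
/-- Reading `LV` of a kernel file. [folklore] -/
@[simp] theorem kout_LV : kout z X0v st .LV = ones (lv z) := by simp [kout]
/-- Reading `BB` of a kernel file. [folklore] -/
@[simp] theorem kout_BB : kout z X0v st .BB = ones (bb z) := by simp [kout]
/-- Reading `MODE` of a kernel file. [folklore] -/
@[simp] theorem kout_MODE : kout z X0v st .MODE = flag (valid z) := by simp [kout]

/-- Writing `S2` of a kernel file. [folklore] -/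
@[simp] theorem update_kout_S2 : Function.update (kout z X0v st) .S2 v = kout z X0v { st with S2 := v } := by
  funext k; cases k <;> simp [kout]
/-- Writing `R` of a kernel file. [folklore] -/
@[simp] theorem update_kout_R : Function.update (kout z X0v st) .R v = kout z X0v { st with R := v } := by
  funext k; cases k <;> simp [kout]
/-- Writing `P` of a kernel file. [folklore] -/
@[simp] theorem update_kout_P : Function.update (kout z X0v st) .P v = kout z X0v { st with P := v } := by
  funext k; cases k <;> simp [kout]
/-- Writing `LC` of a kernel file. [folklore] -/
@[simp] theorem update_kout_LC : Function.update (kout z X0v st) .LC v = kout z X0v { st with LC := v } := by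
  funext k; cases k <;> simp [kout]
/-- Writing `BC` of a kernel file. [folklore] -/
@[simp] theorem update_kout_BC : Function.update (kout z X0v st) .BC v = kout z X0v { st with BC := v } := by
  funext k; cases k <;> simp [kout]
/-- Writing `OUT` of a kernel file. [folklore] -/
@[simp] theorem update_kout_OUT : Function.update (kout z X0v st) .OUT v = kout z X0v { st with OUT := v } := by
  funext k; cases k <;> simp [kout]

/-- Reading an outer register of `kfile`. [folklore] -/
@[simp] theorem kfile_inl (k : K) : kfile z X0v st (Sum.inl k) = kout z X0v st k := rfl
/-- Reading a bank register of `kfile`. [folklore] -/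
@[simp] theorem kfile_inr (r : AReg) : kfile z X0v st (Sum.inr r) = file [] (sndq z) [] [] [] [] [] [] r := rfl

end KFile

/-- The cost of one modular multiplication of registers, in terms of the length `L` of the
modulus. [folklore] -/
def mulCost (L : ℕ) : ℕ := L * (191 * L + 113) + 33 * L + 12

/-- `mulCost` is monotone. [folklore] -/
theorem mulCost_mono {L L' : ℕ} (h : L ≤ L') : mulCost L ≤ mulCost L' := by
  unfold mulCost
  have := Nat.mul_le_mul h (show 191 * L + 113 ≤ 191 * L' + 113 by omega)
  omega

/-- **Simulation of `mulR a b c`** on a kernel file, abstractly: with `a = ea`, `b = eb` reduced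
numerals of values `av`, `bv`, the routine leads to the file with `c := encodeNat (av · bv mod n)`
(the bank and the scratch registers restored), within `mulCost |n|`. The register plumbing is
given as hypotheses so that the three instances used are covered at once. [folklore] -/
theorem runs_mulR {a b c : K} (hc1 : c ≠ .T1) (ha1 : a ≠ .T1) (ha2 : a ≠ .T2) (hb1 : b ≠ .T1) (hb2 : b ≠ .T2)
    (hb3 : b ≠ .T3) (z X0v : List Bool) (st : KSt) (av bv : ℕ)
    (hn : 1 < bitsToNat (sndq z))
    (ha : kout z X0v st a = encodeNat av) (hb : kout z X0v st b = encodeNat bv)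
    (hav : av < bitsToNat (sndq z))
    (hal : (encodeNat av).length ≤ (sndq z).length) (hbl : (encodeNat bv).length ≤ (sndq z).length)
    (hcl : (kout z X0v st c).length ≤ (sndq z).length) :
    Runs (mulR a b c) (kfile z X0v st)
      (Sum.elim (Function.update (kout z X0v st) c (encodeNat (av * bv % bitsToNat (sndq z))))
        (file [] (sndq z) [] [] [] [] [] [])) (mulCost (sndq z).length) ∧
    (encodeNat (av * bv % bitsToNat (sndq z))).length ≤ (sndq z).length := by
  set T0 := kout z X0v st with hT0
  have hn0 : 0 < bitsToNat (sndq z) := by omega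
  have hT1 : T0 .T1 = [] := rfl
  have hT2 : T0 .T2 = [] := rfl
  have hT3 : T0 .T3 = [] := rfl
  have hM : T0 .M = [] := rfl
  -- the product numeral
  have hres : modMulRes (encodeNat bv).reverse [] (sndq z) (encodeNat av) = encodeNat (av * bv % bitsToNat (sndq z)) := by
    rw [modMulRes_nil_eq _ _ _ hn0 (by simpa using hav), List.reverse_reverse, bitsToNat_encodeNat,
      bitsToNat_encodeNat]
  have hresl : (encodeNat (av * bv % bitsToNat (sndq z))).length ≤ (sndq z).length := by
    rw [← hres]; exact length_modMulRes_nil_le _ _ _ hn0 (by simpa using hav)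
  refine ⟨?_, hresl⟩
  -- 1. copy a onto z
  have h1 : Runs (copy (o a) (Sum.inr .z) (o .T1) (o .T2)) (kfile z X0v st)
      (Sum.elim T0 (file [] (sndq z) (encodeNat av) [] [] [] [] [])) (10 * (encodeNat av).length + 3) := by
    refine (runs_copy (a := o a) (b := Sum.inr AReg.z) (t := o .T1) (u := o .T2) (by simp) (by simpa using ha1)
      (by simpa using ha2) (by simp) (by simp) (by decide) (kfile z X0v st) (by simp [kfile])
      (by simp [kfile])).of_eq ?_ ?_
    · simp [kfile, ← hT0, ha, -Sum.elim_update_left, -Sum.elim_update_right]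
    · simp [kfile, ← hT0, ha]
  -- 2. copy b onto T3
  have h2 : Runs (copy (o b) (o .T3) (o .T1) (o .T2)) (Sum.elim T0 (file [] (sndq z) (encodeNat av) [] [] [] [] []))
      (Sum.elim (Function.update T0 .T3 (encodeNat bv)) (file [] (sndq z) (encodeNat av) [] [] [] [] []))
      (10 * (encodeNat bv).length + 3) := by
    refine (runs_copy (a := o b) (b := o K.T3) (t := o .T1) (u := o .T2) (by simpa using hb3) (by simpa using hb1)
      (by simpa using hb2) (by decide) (by decide) (by decide) _ (by simp [hT1]) (by simp [hT2])).of_eq ?_ ?_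
    · simp [hb, hT3, -Sum.elim_update_left, -Sum.elim_update_right]
    · simp [hb]
  -- 3. pour T3 onto M (reversal)
  have h3 : Runs (pour (o .T3) (o .M)) (Sum.elim (Function.update T0 .T3 (encodeNat bv)) (file [] (sndq z) (encodeNat av) [] [] [] [] []))
      (Sum.elim (Function.update T0 .M (encodeNat bv).reverse) (file [] (sndq z) (encodeNat av) [] [] [] [] []))
      (3 * (encodeNat bv).length + 1) := by
    refine (runs_pour (a := o K.T3) (b := o K.M) (by decide) _).of_eq ?_ ?_
    · simp only [Sum.update_elim_inl, Sum.elim_inl, Function.update_self]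
      congr 1
      funext k
      by_cases hk3 : k = K.T3
      · subst hk3; simp [hT3]
      · by_cases hkM : k = K.M
        · subst hkM; simp [hM, hk3]
        · simp [hk3, hkM]
    · simp
  -- 4. modMul
  have h4 : Runs (modMul K.M) (Sum.elim (Function.update T0 .M (encodeNat bv).reverse) (file [] (sndq z) (encodeNat av) [] [] [] [] []))
      (Sum.elim T0 (file (encodeNat (av * bv % bitsToNat (sndq z))) (sndq z) (encodeNat av) [] [] [] [] []))
      ((encodeNat bv).length * (141 * (sndq z).length + 50 * (encodeNat av).length + 113) + 1) := by
    refine (runs_modMul K.M (encodeNat bv).reverse (Function.update T0 .M (encodeNat bv).reverse) [] (sndq z) (encodeNat av)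
      (by simp) (by simpa using hn0) (by simpa using hav) (Nat.zero_le _)).of_eq ?_ (by simp)
    have e : Function.update T0 K.M [] = T0 := Function.update_eq_self_iff.2 hM.symm
    rw [hres, Function.update_idem, e]
  -- 5. clear c
  have h5 : Runs (clear (o c)) (Sum.elim T0 (file (encodeNat (av * bv % bitsToNat (sndq z))) (sndq z) (encodeNat av) [] [] [] [] []))
      (Sum.elim (Function.update T0 c []) (file (encodeNat (av * bv % bitsToNat (sndq z))) (sndq z) (encodeNat av) [] [] [] [] []))
      (2 * (T0 c).length + 1) :=
    (runs_clear (o c) _).of_eq (by simp [-Sum.elim_update_left, -Sum.elim_update_right]) (by simp)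
  -- 6. move the product out
  have h6 : Runs (move (Sum.inr .x) (o c) (o .T1))
      (Sum.elim (Function.update T0 c []) (file (encodeNat (av * bv % bitsToNat (sndq z))) (sndq z) (encodeNat av) [] [] [] [] []))
      (Sum.elim (Function.update T0 c (encodeNat (av * bv % bitsToNat (sndq z)))) (file [] (sndq z) (encodeNat av) [] [] [] [] []))
      (6 * (encodeNat (av * bv % bitsToNat (sndq z))).length + 2) := by
    refine (runs_move (a := Sum.inr AReg.x) (b := o c) (t := o .T1) (by simp) (by simp) (by simpa using hc1) _ ?_).of_eq ?_ ?_
    · simp [Function.update_of_ne (show (K.T1) ≠ c from fun h => hc1 h.symm), hT1]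
    · simp [-Sum.elim_update_left, -Sum.elim_update_right]
    · simp
  -- 7. clear z
  have h7 : Runs (clear (Sum.inr .z))
      (Sum.elim (Function.update T0 c (encodeNat (av * bv % bitsToNat (sndq z)))) (file [] (sndq z) (encodeNat av) [] [] [] [] []))
      (Sum.elim (Function.update T0 c (encodeNat (av * bv % bitsToNat (sndq z)))) (file [] (sndq z) [] [] [] [] [] []))
      (2 * (encodeNat av).length + 1) :=
    (runs_clear (Sum.inr AReg.z) _).of_eq (by simp [-Sum.elim_update_left, -Sum.elim_update_right]) (by simp)
  refine ((h1.seq (h2.seq (h3.seq (h4.seq (h5.seq (h6.seq h7))))))).of_eq rfl ?_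
  have h50 : 50 * (encodeNat av).length ≤ 50 * (sndq z).length := Nat.mul_le_mul_left _ hal
  have hprod : (encodeNat bv).length * (141 * (sndq z).length + 50 * (encodeNat av).length + 113) ≤
      (sndq z).length * (191 * (sndq z).length + 113) := Nat.mul_le_mul hbl (by omega)
  rw [mulCost]
  omega

/-- Lengths of reduced numerals: a residue modulo `n > 1` is never longer than the numeral of
`n` (it is a `modMul` result). [folklore] -/
theorem length_encodeNat_le {n : List Bool} (hn : 1 < bitsToNat n) {v : ℕ} (hv : v < bitsToNat n) :
    (encodeNat v).length ≤ n.length := by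
  have h := length_modMulRes_nil_le (encodeNat v).reverse n [true] (by omega) (by simpa using hn)
  rwa [modMulRes_nil_eq _ _ _ (by omega) (by simpa using hn), List.reverse_reverse, bitsToNat_encodeNat,
    show bitsToNat [true] = 1 by simp, one_mul, Nat.mod_eq_of_lt hv] at h

/-! ### One control bit and the bit loop -/

/-- One step of the bit loop on `(r, stream)`. [folklore] -/
def bstep (n p : ℕ) : ℕ × List Bool → ℕ × List Bool
  | (r, []) => (r, [])
  | (r, b :: S) => (if b then r * p % n else r, S)

/-- The bit loop, one more step at the end. [folklore] -/
theorem bitLoop_succ (n p : ℕ) : ∀ (i r : ℕ) (S : List Bool),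
    bitLoop n p r (i + 1) S = bstep n p (bitLoop n p r i S)
  | 0, r, [] => rfl
  | 0, r, b :: S => rfl
  | i + 1, r, [] => by
    show ((r, []) : ℕ × List Bool) = bstep n p (bitLoop n p r (i + 1) [])
    rw [show bitLoop n p r (i + 1) [] = (r, []) from rfl]; rfl
  | i + 1, r, b :: S => by
    rw [bitLoop, bitLoop_succ n p i _ S]; rfl

/-- The bit loop keeps the residue reduced. [folklore] -/
theorem bitLoop_lt {n p : ℕ} (hn : 0 < n) : ∀ (i r : ℕ) (S : List Bool), r < n → (bitLoop n p r i S).1 < n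
  | 0, r, S, h => h
  | i + 1, r, [], h => h
  | i + 1, r, b :: S, h => by
    rw [bitLoop]
    refine bitLoop_lt hn i _ S ?_
    cases b
    · simpa using h
    · exact Nat.mod_lt _ hn

/-- Writing an outer register of a kernel file. [folklore] -/
theorem update_kfile_inl (z X0v : List Bool) (st : KSt) (k : K) (v : List Bool) :
    Function.update (kfile z X0v st) (Sum.inl k) v = Sum.elim (Function.update (kout z X0v st) k v)
      (file [] (sndq z) [] [] [] [] [] []) := by
  rw [kfile, Sum.update_elim_inl]

/-- The kernel state after one control bit. [folklore] -/
def bitNext (n pv rv : ℕ) (st : KSt) : KSt :=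
  let q := bstep n pv (rv, st.S2)
  { st with S2 := q.2, R := encodeNat q.1 }

/-- **Simulation of `bitC`.** [folklore] -/
theorem runs_bitC (z X0v : List Bool) (st : KSt) (rv pv : ℕ) (hn : 1 < bitsToNat (sndq z))
    (hR : st.R = encodeNat rv) (hP : st.P = encodeNat pv) (hrv : rv < bitsToNat (sndq z)) (hpv : pv < bitsToNat (sndq z)) :
    Runs bitC (kfile z X0v st) (kfile z X0v (bitNext (bitsToNat (sndq z)) pv rv st))
      (mulCost (sndq z).length + 2) := by
  obtain ⟨S2, R, P, LC, BC, OUT⟩ := st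
  simp only at hR hP
  subst hR hP
  rcases S2 with _ | ⟨b, S'⟩
  · exact (Runs.pop_nil _ _ rfl (Runs.skip _)).of_eq rfl (by omega)
  · cases b
    · have h : Runs bitC (kfile z X0v ⟨false :: S', encodeNat rv, encodeNat pv, LC, BC, OUT⟩)
          (Function.update (kfile z X0v ⟨false :: S', encodeNat rv, encodeNat pv, LC, BC, OUT⟩) (o .S2) S') (0 + 2) :=
        Runs.pop_false _ _ (k := o .S2) (w := S') rfl (Runs.skip _)
      refine h.of_eq ?_ (by omega)
      rw [update_kfile_inl, update_kout_S2]
      rfl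
    · have hm := (runs_mulR (a := .R) (b := .P) (c := .R) (by decide) (by decide) (by decide) (by decide) (by decide)
        (by decide) z X0v ⟨S', encodeNat rv, encodeNat pv, LC, BC, OUT⟩ rv pv hn rfl rfl hrv
        (length_encodeNat_le hn hrv) (length_encodeNat_le hn hpv)
        (by simpa using length_encodeNat_le hn hrv)).1
      have h : Runs bitC (kfile z X0v ⟨true :: S', encodeNat rv, encodeNat pv, LC, BC, OUT⟩)
          (Sum.elim (Function.update (kout z X0v ⟨S', encodeNat rv, encodeNat pv, LC, BC, OUT⟩) K.R
            (encodeNat (rv * pv % bitsToNat (sndq z)))) (file [] (sndq z) [] [] [] [] [] []))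
          (mulCost (sndq z).length + 2) :=
        Runs.pop_true _ _ (k := o .S2) (w := S') rfl (by rw [update_kfile_inl, update_kout_S2]; exact hm)
      refine h.of_eq ?_ le_rfl
      rw [update_kout_R]
      rfl

/-- The kernel state after `i` control bits of the current level, with bit counter `w`. [folklore] -/
def bitSt (n pv rv : ℕ) (st : KSt) (w : List Bool) (i : ℕ) : KSt :=
  ⟨(bitLoop n pv rv i st.S2).2, encodeNat (bitLoop n pv rv i st.S2).1, st.P, st.LC, w, st.OUT⟩

/-- One more bit. [folklore] -/
theorem bitNext_bitSt (n pv rv : ℕ) (st : KSt) (w : List Bool) (i : ℕ) :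
    bitNext n pv (bitLoop n pv rv i st.S2).1 (bitSt n pv rv st w i) = bitSt n pv rv st w (i + 1) := by
  simp only [bitNext, bitSt, bitLoop_succ, Prod.mk.eta]

/-- **Simulation of the bit loop** `loop BC bitC bitC`: `|BC|` control bits are processed.
[folklore] -/
theorem runs_bitLoopC (z X0v : List Bool) (st : KSt) (rv pv : ℕ) (hn : 1 < bitsToNat (sndq z))
    (hR : st.R = encodeNat rv) (hP : st.P = encodeNat pv) (hrv : rv < bitsToNat (sndq z)) (hpv : pv < bitsToNat (sndq z)) :
    Runs (loop (o .BC) bitC bitC) (kfile z X0v st)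
      (kfile z X0v (bitSt (bitsToNat (sndq z)) pv rv st [] st.BC.length))
      ((mulCost (sndq z).length + 4) * st.BC.length + 1) := by
  set nv := bitsToNat (sndq z)
  have h := runs_indexLoop (c := o .BC) (body := bitC) (fun i => kfile z X0v (bitSt nv pv rv st [] i))
    (mulCost (sndq z).length + 2) (fun i => rfl) st.BC 0 (fun i _ _ w => by
      rw [update_kfile_inl, update_kout_BC, update_kfile_inl, update_kout_BC]
      have e1 : ({ bitSt nv pv rv st [] i with BC := w } : KSt) = bitSt nv pv rv st w i := rfl
      have e2 : ({ bitSt nv pv rv st [] (i + 1) with BC := w } : KSt) = bitSt nv pv rv st w (i + 1) := rfl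
      rw [show Sum.elim (kout z X0v { bitSt nv pv rv st [] i with BC := w }) (file [] (sndq z) [] [] [] [] [] []) =
          kfile z X0v (bitSt nv pv rv st w i) from by rw [e1]; rfl,
        show Sum.elim (kout z X0v { bitSt nv pv rv st [] (i + 1) with BC := w }) (file [] (sndq z) [] [] [] [] [] []) =
          kfile z X0v (bitSt nv pv rv st w (i + 1)) from by rw [e2]; rfl, ← bitNext_bitSt]
      exact runs_bitC z X0v _ _ pv hn rfl hP (bitLoop_lt (by omega) i rv st.S2 hrv) hpv)
  have hstart : Function.update (kfile z X0v (bitSt nv pv rv st [] 0)) (o .BC) st.BC = kfile z X0v st := by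
    rw [update_kfile_inl, update_kout_BC]
    obtain ⟨S2, R, P, LC, BC, OUT⟩ := st
    simp only at hR
    subst hR
    rfl
  rw [zero_add, hstart] at h
  exact h.of_eq rfl (by ring_nf; omega)

/-! ### One level and the level loop -/

/-- One step of the level loop on `(p, r, stream)`. [folklore] -/
def lstep (n m : ℕ) (q : ℕ × ℕ × List Bool) : ℕ × ℕ × List Bool :=
  (q.1 * q.1 % n, (bitLoop n q.1 q.2.1 m q.2.2).1, (bitLoop n q.1 q.2.1 m q.2.2).2)

/-- The level loop, one more level at the end. [folklore] -/
theorem levelLoop_succ (n m : ℕ) : ∀ (k p r : ℕ) (S : List Bool),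
    levelLoop n m p r (k + 1) S = lstep n m (levelLoop n m p r k S)
  | 0, p, r, S => rfl
  | k + 1, p, r, S => by
    rw [levelLoop, levelLoop_succ n m k, levelLoop]

/-- The level loop keeps power and residue reduced. [folklore] -/
theorem levelLoop_lt {n m : ℕ} (hn : 0 < n) : ∀ (k p r : ℕ) (S : List Bool), p < n → r < n →
    (levelLoop n m p r k S).1 < n ∧ (levelLoop n m p r k S).2.1 < n
  | 0, p, r, S, hp, hr => ⟨hp, hr⟩
  | k + 1, p, r, S, hp, hr => by
    rw [levelLoop]
    exact levelLoop_lt hn k _ _ _ (Nat.mod_lt _ hn) (bitLoop_lt hn m r S hr)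

/-- The cost of one level, in terms of the modulus length `L` and the block length `bb`.
[folklore] -/
def levelCost (L bb : ℕ) : ℕ := 10 * bb + 3 + ((mulCost L + 4) * bb + 1) + mulCost L

/-- **Simulation of `levelC`**: `bb` control bits, then `P := P² mod n`. [folklore] -/
theorem runs_levelC (z X0v : List Bool) (st : KSt) (rv pv : ℕ) (hn : 1 < bitsToNat (sndq z))
    (hR : st.R = encodeNat rv) (hP : st.P = encodeNat pv) (hrv : rv < bitsToNat (sndq z))
    (hpv : pv < bitsToNat (sndq z)) (hBC : st.BC = []) :
    Runs levelC (kfile z X0v st)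
      (kfile z X0v ⟨(bitLoop (bitsToNat (sndq z)) pv rv (bb z) st.S2).2,
        encodeNat (bitLoop (bitsToNat (sndq z)) pv rv (bb z) st.S2).1,
        encodeNat (pv * pv % bitsToNat (sndq z)), st.LC, [], st.OUT⟩)
      (levelCost (sndq z).length (bb z)) := by
  set nv := bitsToNat (sndq z) with hnv
  obtain ⟨S2, R, P, LC, BC, OUT⟩ := st
  simp only at hR hP hBC
  subst hR hP hBC
  -- 1. the bit counter
  have h1 : Runs (copy (o .BB) (o .BC) (o .T1) (o .T2)) (kfile z X0v ⟨S2, encodeNat rv, encodeNat pv, LC, [], OUT⟩)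
      (kfile z X0v ⟨S2, encodeNat rv, encodeNat pv, LC, ones (bb z), OUT⟩) (10 * bb z + 3) := by
    refine (runs_copy (a := o K.BB) (b := o K.BC) (t := o .T1) (u := o .T2) (by decide) (by decide) (by decide)
      (by decide) (by decide) (by decide) _ rfl rfl).of_eq ?_ (by simp)
    rw [update_kfile_inl]
    simp only [kfile_inl, kout_BB, kout_BC, List.append_nil, update_kout_BC]
    rfl
  -- 2. the bit loop
  have h2 := runs_bitLoopC z X0v ⟨S2, encodeNat rv, encodeNat pv, LC, ones (bb z), OUT⟩ rv pv hn rfl rfl hrv hpv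
  simp only [List.length_replicate] at h2
  -- 3. the squaring
  have h3 := (runs_mulR (a := .P) (b := .P) (c := .P) (by decide) (by decide) (by decide) (by decide) (by decide)
    (by decide) z X0v (bitSt nv pv rv ⟨S2, encodeNat rv, encodeNat pv, LC, ones (bb z), OUT⟩ [] (bb z)) pv pv hn
    rfl rfl hpv (length_encodeNat_le hn hpv) (length_encodeNat_le hn hpv)
    (by simpa [bitSt] using length_encodeNat_le hn hpv)).1
  refine (h1.seq (h2.seq h3)).of_eq ?_ (by unfold levelCost; omega)
  rw [update_kout_P]
  rfl

/-- The kernel state after `k` levels of the current trial, with level counter `w`. [folklore] -/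
def lvSt (n m p r : ℕ) (st : KSt) (w : List Bool) (k : ℕ) : KSt :=
  ⟨(levelLoop n m p r k st.S2).2.2, encodeNat (levelLoop n m p r k st.S2).2.1,
    encodeNat (levelLoop n m p r k st.S2).1, w, [], st.OUT⟩

/-- **Simulation of the level loop** `loop LC levelC levelC`: `|LC|` levels are processed.
[folklore] -/
theorem runs_levelLoopC (z X0v : List Bool) (st : KSt) (r0 p0 : ℕ) (hn : 1 < bitsToNat (sndq z))
    (hR : st.R = encodeNat r0) (hP : st.P = encodeNat p0) (hr0 : r0 < bitsToNat (sndq z))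
    (hp0 : p0 < bitsToNat (sndq z)) (hBC : st.BC = []) :
    Runs (loop (o .LC) levelC levelC) (kfile z X0v st)
      (kfile z X0v (lvSt (bitsToNat (sndq z)) (bb z) p0 r0 st [] st.LC.length))
      ((levelCost (sndq z).length (bb z) + 2) * st.LC.length + 1) := by
  set nv := bitsToNat (sndq z) with hnv
  have h := runs_indexLoop (c := o .LC) (body := levelC) (fun k => kfile z X0v (lvSt nv (bb z) p0 r0 st [] k))
    (levelCost (sndq z).length (bb z)) (fun k => rfl) st.LC 0 (fun k _ _ w => by
      rw [update_kfile_inl, update_kout_LC, update_kfile_inl, update_kout_LC]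
      have hlt := levelLoop_lt (m := bb z) (show 0 < nv by omega) k p0 r0 st.S2 hp0 hr0
      have hl := runs_levelC z X0v { lvSt nv (bb z) p0 r0 st [] k with LC := w } _ _ hn rfl rfl hlt.2 hlt.1 rfl
      refine hl.of_eq ?_ le_rfl
      simp only [lvSt, levelLoop_succ, lstep]
      rfl)
  have hstart : Function.update (kfile z X0v (lvSt nv (bb z) p0 r0 st [] 0)) (o .LC) st.LC = kfile z X0v st := by
    rw [update_kfile_inl, update_kout_LC]
    obtain ⟨S2, R, P, LC, BC, OUT⟩ := st
    simp only at hR hP hBC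
    subst hR hP hBC
    rfl
  rw [zero_add, hstart] at h
  exact h

/-! ### One trial -/

/-- The cost of one trial. [folklore] -/
def trialCost (L lv bb : ℕ) : ℕ := (levelCost L bb + 2) * lv + 16 * L + 10 * lv + 13

/-- **Simulation of `trialC`**: from `R = []`, the residue of the trial is emitted onto `OUT`
(coded, reversed), the stream advanced, and `P` left holding the last power. [folklore] -/
theorem runs_trialC (z X0v : List Bool) (st : KSt) (xv : ℕ) (hn : 1 < bitsToNat (sndq z))
    (hX0 : X0v = encodeNat (xv % bitsToNat (sndq z))) (hR : st.R = []) (hPl : st.P.length ≤ (sndq z).length)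
    (hLC : st.LC = []) (hBC : st.BC = []) :
    Runs trialC (kfile z X0v st)
      (kfile z X0v ⟨(trial xv (bitsToNat (sndq z)) (lv z) (bb z) st.S2).2, [],
        encodeNat (levelLoop (bitsToNat (sndq z)) (bb z) (xv % bitsToNat (sndq z)) 1 (lv z) st.S2).1, [], [],
        true :: false :: (((encodeNat (trial xv (bitsToNat (sndq z)) (lv z) (bb z) st.S2).1).flatMap fun b => [b, b]).reverse
          ++ st.OUT)⟩)
      (trialCost (sndq z).length (lv z) (bb z)) := by
  set nv := bitsToNat (sndq z) with hnv
  have hx : xv % nv < nv := Nat.mod_lt _ (by omega)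
  have h1lt : 1 < nv := hn
  obtain ⟨S2, R, P, LC, BC, OUT⟩ := st
  simp only at hR hPl hLC hBC
  subst hR hLC hBC
  -- 1. clear R (already empty)
  have h1 : Runs (clear (o .R)) (kfile z X0v ⟨S2, [], P, [], [], OUT⟩) (kfile z X0v ⟨S2, [], P, [], [], OUT⟩) 1 :=
    (runs_clear (o K.R) _).of_eq (by rw [update_kfile_inl, update_kout_R]; rfl) (by simp)
  -- 2. R := 1
  have h2 : Runs (Com.push (o .R) true) (kfile z X0v ⟨S2, [], P, [], [], OUT⟩) (kfile z X0v ⟨S2, [true], P, [], [], OUT⟩) 1 :=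
    Runs.push' (by rw [update_kfile_inl, update_kout_R]; rfl)
  -- 3. clear P
  have h3 : Runs (clear (o .P)) (kfile z X0v ⟨S2, [true], P, [], [], OUT⟩) (kfile z X0v ⟨S2, [true], [], [], [], OUT⟩)
      (2 * P.length + 1) :=
    (runs_clear (o K.P) _).of_eq (by rw [update_kfile_inl, update_kout_P]; rfl) (by simp)
  -- 4. P := x mod n
  have h4 : Runs (copy (o .X0) (o .P) (o .T1) (o .T2)) (kfile z X0v ⟨S2, [true], [], [], [], OUT⟩)
      (kfile z X0v ⟨S2, [true], X0v, [], [], OUT⟩) (10 * X0v.length + 3) := by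
    refine (runs_copy (a := o K.X0) (b := o K.P) (t := o .T1) (u := o .T2) (by decide) (by decide) (by decide)
      (by decide) (by decide) (by decide) _ rfl rfl).of_eq ?_ (by simp)
    rw [update_kfile_inl]
    simp only [kfile_inl, kout_X0, kout_P, List.append_nil, update_kout_P]
    rfl
  -- 5. the level counter
  have h5 : Runs (copy (o .LV) (o .LC) (o .T1) (o .T2)) (kfile z X0v ⟨S2, [true], X0v, [], [], OUT⟩)
      (kfile z X0v ⟨S2, [true], X0v, ones (lv z), [], OUT⟩) (10 * lv z + 3) := by
    refine (runs_copy (a := o K.LV) (b := o K.LC) (t := o .T1) (u := o .T2) (by decide) (by decide) (by decide)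
      (by decide) (by decide) (by decide) _ rfl rfl).of_eq ?_ (by simp)
    rw [update_kfile_inl]
    simp only [kfile_inl, kout_LV, kout_LC, List.append_nil, update_kout_LC]
    rfl
  -- 6. the level loop
  have h6 := runs_levelLoopC z X0v ⟨S2, [true], X0v, ones (lv z), [], OUT⟩ 1 (xv % nv) hn
    (show [true] = encodeNat 1 by decide) (by simpa using hX0) h1lt hx rfl
  simp only [List.length_replicate] at h6
  -- 7. emit
  have h7 := runs_emit (h := o K.R) (o := o K.OUT) (by decide)
    (kfile z X0v (lvSt nv (bb z) (xv % nv) 1 ⟨S2, [true], X0v, ones (lv z), [], OUT⟩ [] (lv z)))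
  have hres : (levelLoop nv (bb z) (xv % nv) 1 (lv z) S2).2.1 < nv := (levelLoop_lt (by omega) _ _ _ _ hx h1lt).2
  refine (h1.seq (h2.seq (h3.seq (h4.seq (h5.seq (h6.seq h7)))))).of_eq ?_ ?_
  · rw [update_kfile_inl, update_kout_R, Sum.update_elim_inl, update_kout_OUT]
    simp only [kfile_inl, kout_R, kout_OUT, lvSt, trial]
    rfl
  · simp only [kfile_inl, kout_R, lvSt, trialCost]
    have hl1 := length_encodeNat_le hn hres
    have hl2 : X0v.length ≤ (sndq z).length := by rw [hX0]; exact length_encodeNat_le hn hx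
    nlinarith [hl1, hl2, hPl]

/-! ### The kernel -/

/-- A valid instance has modulus `> 1`. [folklore] -/
theorem one_lt_of_valid {z : List Bool} (hv : valid z = true) : 1 < bitsToNat (sndq z) := by
  simp only [valid, Bool.and_eq_true, canonTop_reverse, decide_eq_true_eq] at hv
  exact (one_lt_bitsToNat_iff hv.1.2).2 hv.2

/-- The reduced base `x mod n` as a numeral. [folklore] -/
def X0v (z : List Bool) : List Bool := encodeNat (bitsToNat (fstq z) % bitsToNat (sndq z))

/-- The kernel state at the start of the trials. [folklore] -/
def kst0 (z : List Bool) : KSt := ⟨ys z, [], [], [], [], []⟩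

/-- The register file at the start of the trials is a kernel file. [folklore] -/
theorem setup_eq (z : List Bool) :
    (Sum.elim (mk ((K.X0, X0v z) :: (K.A, []) :: (K.T, []) :: parsed z)) (file [] (sndq z) [] [] [] [] [] []) : Regs RR) =
      kfile z (X0v z) (kst0 z) := by
  funext r
  rcases r with k | r
  · cases k <;> simp [kfile, kout, kst0, mk_cons]
  · rfl

/-- The cost of the setup of the kernel (modulus, base reduction) in terms of the input length.
[folklore] -/
def setupCost (s : ℕ) : ℕ := s * (141 * s + 163) + 9 * s + 8

/-- **Simulation of the setup**: modulus into the bank, `X0 := x mod n`. [folklore] -/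
theorem runs_setup (z : List Bool) (hv : valid z = true) :
    Runs setupC (Sum.elim (mk (parsed z)) bank0) (kfile z (X0v z) (kst0 z)) (setupCost z.length) := by
  have hn := one_lt_of_valid hv
  have hn0 : 0 < bitsToNat (sndq z) := by omega
  have hpre : (pre z).length ≤ z.length := (Nat.le_add_right _ _).trans (length_pre_le z)
  have hwq : (wq z).length ≤ z.length := (List.take_prefix _ _).length_le.trans hpre
  have hfst : (fstq z).length ≤ z.length := (length_boolUnpair_fst_le _).trans hwq
  have hsnd : (sndq z).length ≤ z.length := (length_boolUnpair_snd_le _).trans hwq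
  have hres : modMulRes (fstq z).reverse [] (sndq z) [true] = X0v z := by
    rw [modMulRes_nil_eq _ _ _ hn0 (by simpa using hn), X0v, List.reverse_reverse]
    simp
  have hX0l : (X0v z).length ≤ (sndq z).length := by
    rw [← hres]; exact length_modMulRes_nil_le _ _ _ hn0 (by simpa using hn)
  have h1 : Runs _ (Sum.elim (mk (parsed z)) bank0 : Regs RR)
      (Sum.elim (mk ((K.T, []) :: parsed z)) (file [] (sndq z) [] [] [] [] [] [])) _ :=
    (runs_pour (a := o .T) (b := Sum.inr AReg.y) (by decide) (Sum.elim (mk (parsed z)) bank0)).of_eq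
      (by simp [-Sum.elim_update_left, -Sum.elim_update_right]) le_rfl
  have h2 : Runs (Com.push (Sum.inr .z) true) (Sum.elim (mk ((K.T, []) :: parsed z)) (file [] (sndq z) [] [] [] [] [] []) : Regs RR)
      (Sum.elim (mk ((K.T, []) :: parsed z)) (file [] (sndq z) [true] [] [] [] [] [])) 1 :=
    Runs.push' (by simp [-Sum.elim_update_left, -Sum.elim_update_right])
  have h3 : Runs (modMul K.A) (Sum.elim (mk ((K.T, []) :: parsed z)) (file [] (sndq z) [true] [] [] [] [] []) : Regs RR)
      (Sum.elim (mk ((K.A, []) :: (K.T, []) :: parsed z)) (file (X0v z) (sndq z) [true] [] [] [] [] []))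
      ((fstq z).length * (141 * (sndq z).length + 50 * 1 + 113) + 1) := by
    refine (runs_modMul K.A (fstq z).reverse (mk ((K.T, []) :: parsed z)) [] (sndq z) [true]
      (by simp) (by simpa using hn0) (by simpa using hn) (Nat.zero_le _)).of_eq ?_ (by simp)
    rw [hres, update_mk]
  have h4 : Runs (move (Sum.inr .x) (o .X0) (o .T1))
      (Sum.elim (mk ((K.A, []) :: (K.T, []) :: parsed z)) (file (X0v z) (sndq z) [true] [] [] [] [] []) : Regs RR)
      (Sum.elim (mk ((K.X0, X0v z) :: (K.A, []) :: (K.T, []) :: parsed z)) (file [] (sndq z) [true] [] [] [] [] []))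
      (6 * (X0v z).length + 2) :=
    (runs_move (a := Sum.inr AReg.x) (b := o .X0) (t := o .T1) (by decide) (by decide) (by decide) _ (by simp)).of_eq
      (by simp [-Sum.elim_update_left, -Sum.elim_update_right]) (by simp)
  have h5 : Runs (clear (Sum.inr .z))
      (Sum.elim (mk ((K.X0, X0v z) :: (K.A, []) :: (K.T, []) :: parsed z)) (file [] (sndq z) [true] [] [] [] [] []) : Regs RR)
      (kfile z (X0v z) (kst0 z)) 3 :=
    (runs_clear (Sum.inr AReg.z) _).of_eq (by rw [← setup_eq]; simp [-Sum.elim_update_left, -Sum.elim_update_right]) (by simp)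
  refine (h1.seq (h2.seq (h3.seq (h4.seq h5)))).of_eq rfl ?_
  have h141 : (fstq z).length * (141 * (sndq z).length + 50 + 113) ≤ z.length * (141 * z.length + 163) :=
    Nat.mul_le_mul hfst (by omega)
  simp [setupCost]
  omega

/-- Lengths: the modulus numeral is not longer than the input. [folklore] -/
theorem length_sndq_le (z : List Bool) : (sndq z).length ≤ z.length :=
  (length_boolUnpair_snd_le _).trans ((List.take_prefix _ _).length_le.trans
    ((Nat.le_add_right _ _).trans (length_pre_le z)))

/-- `ℓ ≤ |z|` hence `2ℓ + 1 ≤ 2|z| + 1`. [folklore] -/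
theorem lv_le (z : List Bool) : lv z ≤ 2 * z.length + 1 := by
  have := ell_le z; rw [lv]; omega

/-- The cost of the kernel in terms of the modulus length `L`, the numbers of levels `lv` and of
control bits per level `bb`, and the input length `s`. [folklore] -/
def kernelCost (L lv bb s : ℕ) : ℕ := setupCost s + 4 * trialCost L lv bb + (24 * L + 26)

/-- The four residues, as numerals. [folklore] -/
def results (z : List Bool) : List (List Bool) :=
  (trials (bitsToNat (fstq z)) (bitsToNat (sndq z)) (lv z) (bb z) 4 (ys z)).map encodeNat

/-- **Simulation of the kernel** on a valid instance: it leaves `encList (results z)` in `RES`.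
[folklore] -/
theorem runs_kernel (z : List Bool) (hv : valid z = true) :
    ∃ Rf : Regs RR, Runs kernel (Sum.elim (mk (parsed z)) bank0) Rf
      (kernelCost (sndq z).length (lv z) (bb z) z.length) ∧ Rf (o .RES) = encList (results z) := by
  have hn := one_lt_of_valid hv
  have hn0 : 0 < bitsToNat (sndq z) := by omega
  set xv := bitsToNat (fstq z) with hxv
  set nv := bitsToNat (sndq z) with hnv
  -- the streams and residues of the four trials
  set S0 := ys z with hS0
  set S1 := (trial xv nv (lv z) (bb z) S0).2 with hS1
  set S2 := (trial xv nv (lv z) (bb z) S1).2 with hS2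
  set S3 := (trial xv nv (lv z) (bb z) S2).2 with hS3
  set e0 := encodeNat (trial xv nv (lv z) (bb z) S0).1 with he0
  set e1 := encodeNat (trial xv nv (lv z) (bb z) S1).1 with he1
  set e2 := encodeNat (trial xv nv (lv z) (bb z) S2).1 with he2
  set e3 := encodeNat (trial xv nv (lv z) (bb z) S3).1 with he3
  have hres : results z = [e0, e1, e2, e3] := by
    simp [results, trials, he0, he1, he2, he3, hS1, hS2, hS3, hS0, hxv, hnv]
  -- bounds
  have hx : xv % nv < nv := Nat.mod_lt _ hn0
  have hP : ∀ S, (encodeNat (levelLoop nv (bb z) (xv % nv) 1 (lv z) S).1).length ≤ (sndq z).length := fun S =>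
    length_encodeNat_le hn (levelLoop_lt hn0 _ _ _ _ hx hn).1
  have he : ∀ S, (encodeNat (trial xv nv (lv z) (bb z) S).1).length ≤ (sndq z).length := fun S =>
    length_encodeNat_le hn (levelLoop_lt hn0 _ _ _ _ hx hn).2
  have hdbl : ∀ l : List Bool, (l.flatMap fun b => [b, b]).length = 2 * l.length := fun l => by
    induction l with
    | nil => rfl
    | cons b l ih => simp [List.flatMap_cons, ih]; ring
  -- setup and the four trials
  have h0 := runs_setup z hv
  have t1 := runs_trialC z (X0v z) (kst0 z) xv hn rfl rfl (by simp [kst0]) rfl rfl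
  have t2' := runs_trialC z (X0v z)
    ⟨S1, [], encodeNat (levelLoop nv (bb z) (xv % nv) 1 (lv z) S0).1, [], [],
      true :: false :: ((e0.flatMap fun b => [b, b]).reverse ++ [])⟩ xv hn rfl rfl (hP S0) rfl rfl
  have t3' := runs_trialC z (X0v z)
    ⟨S2, [], encodeNat (levelLoop nv (bb z) (xv % nv) 1 (lv z) S1).1, [], [],
      true :: false :: ((e1.flatMap fun b => [b, b]).reverse ++
        (true :: false :: ((e0.flatMap fun b => [b, b]).reverse ++ [])))⟩ xv hn rfl rfl (hP S1) rfl rfl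
  have t4' := runs_trialC z (X0v z)
    ⟨S3, [], encodeNat (levelLoop nv (bb z) (xv % nv) 1 (lv z) S2).1, [], [],
      true :: false :: ((e2.flatMap fun b => [b, b]).reverse ++
        (true :: false :: ((e1.flatMap fun b => [b, b]).reverse ++
          (true :: false :: ((e0.flatMap fun b => [b, b]).reverse ++ [])))))⟩ xv hn rfl rfl (hP S2) rfl rfl
  -- the output
  set F4 := kfile z (X0v z)
    ⟨(trial xv nv (lv z) (bb z) S3).2, [], encodeNat (levelLoop nv (bb z) (xv % nv) 1 (lv z) S3).1, [], [],
      true :: false :: ((e3.flatMap fun b => [b, b]).reverse ++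
        (true :: false :: ((e2.flatMap fun b => [b, b]).reverse ++
          (true :: false :: ((e1.flatMap fun b => [b, b]).reverse ++
            (true :: false :: ((e0.flatMap fun b => [b, b]).reverse ++ [])))))))⟩ with hF4
  have hOUT : F4 (o .OUT) = outRev [e0, e1, e2, e3] := by
    rw [hF4, kfile_inl, kout_OUT, show [e0, e1, e2, e3] = (([] ++ [e0]) ++ [e1]) ++ [e2] ++ [e3] by simp,
      outRev_append, outRev_append, outRev_append, outRev_append, outRev_nil]
  have h5 := runs_pour (a := o .OUT) (b := o .RES) (by decide) F4
  refine ⟨_, (h0.seq (t1.seq (t2'.seq (t3'.seq (t4'.seq h5))))).of_eq rfl ?_, ?_⟩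
  · have hlen : (F4 (o .OUT)).length ≤ 8 * (sndq z).length + 8 := by
      rw [hOUT, outRev, List.length_reverse]
      simp only [List.flatMap_cons, List.flatMap_nil, List.append_nil, List.length_append, hdbl,
        List.length_cons, List.length_nil]
      have hl0 : e0.length ≤ (sndq z).length := he S0
      have hl1 : e1.length ≤ (sndq z).length := he S1
      have hl2 : e2.length ≤ (sndq z).length := he S2
      have hl3 : e3.length ≤ (sndq z).length := he S3
      omega
    rw [kernelCost]
    omega
  · rw [Function.update_self, hOUT, hres, hF4, kfile_inl, kout_RES, List.append_nil, outRev,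
      List.reverse_reverse, encList_eq_flatMap]

/-! ### The whole program: function and polynomial running time -/

/-- **The function of the block machine**: on a valid instance the coded list of the four residues,
otherwise the empty string. [folklore] -/
def blockFn (z : List Bool) : List Bool := if valid z then encList (results z) else []

/-- `bb ≤ 12288 (2|z| + 1)`. [folklore] -/
theorem bb_le (z : List Bool) : bb z ≤ 12288 * (2 * z.length + 1) := by
  rw [bb]; exact Nat.mul_le_mul_left _ (lv_le z)

/-- `levelCost` is monotone. [folklore] -/
theorem levelCost_mono {L L' b b' : ℕ} (hL : L ≤ L') (hb : b ≤ b') : levelCost L b ≤ levelCost L' b' := by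
  unfold levelCost
  have h1 := mulCost_mono hL
  have h2 : (mulCost L + 4) * b ≤ (mulCost L' + 4) * b' := Nat.mul_le_mul (by omega) hb
  omega

/-- `trialCost` is monotone. [folklore] -/
theorem trialCost_mono {L L' v v' b b' : ℕ} (hL : L ≤ L') (hv : v ≤ v') (hb : b ≤ b') :
    trialCost L v b ≤ trialCost L' v' b' := by
  unfold trialCost
  have h1 : (levelCost L b + 2) * v ≤ (levelCost L' b' + 2) * v' :=
    Nat.mul_le_mul (Nat.add_le_add_right (levelCost_mono hL hb) 2) hv
  omega

/-- The cost of the whole program in terms of the input length. [folklore] -/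
def progCost (s : ℕ) : ℕ :=
  parseCost s + 3 + kernelCost s (2 * s + 1) (12288 * (2 * s + 1)) s

/-- **Simulation of the whole program**: on every input `z` it leaves `blockFn z` in `RES`
within `progCost |z|` steps. [folklore] -/
theorem runs_prog (z : List Bool) :
    ∃ Rf : Regs RR, Runs prog (Regs.init (o .inp) z) Rf (progCost z.length) ∧ Rf (o .RES) = blockFn z := by
  rw [init_eq, blockFn]
  have hp := runs_parse z
  have hMODE : (Sum.elim (mk (parsed z)) bank0 : Regs RR) (o .MODE) = flag (valid z) := by simp
  by_cases hv : valid z = true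
  · obtain ⟨Rf, hk, hout⟩ := runs_kernel z hv
    refine ⟨Rf, (hp.seq (runs_ifFlag_true _ (by rw [hMODE, hv]) hk)).of_eq rfl ?_, by rw [hout, if_pos hv]⟩
    have hk : kernelCost (sndq z).length (lv z) (bb z) z.length ≤
        kernelCost z.length (2 * z.length + 1) (12288 * (2 * z.length + 1)) z.length := by
      unfold kernelCost
      have := trialCost_mono (length_sndq_le z) (lv_le z) (bb_le z)
      have := length_sndq_le z
      omega
    rw [progCost]; omega
  · have hvf : valid z = false := by simpa using hv
    refine ⟨_, (hp.seq (runs_ifFlag_false _ (by rw [hMODE, hvf]) (Runs.skip _))).of_eq rfl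
      (by rw [progCost]; omega), ?_⟩
    rw [if_neg hv]
    simp

/-- The step-bound polynomial of the program. [folklore] -/
def costPoly : Polynomial ℕ :=
  let X : Polynomial ℕ := Polynomial.X
  let L := X
  let V := 2 * X + 1
  let B := 12288 * (2 * X + 1)
  let mulC := L * (191 * L + 113) + 33 * L + 12
  let levelC := 10 * B + 3 + ((mulC + 4) * B + 1) + mulC
  let trialC := (levelC + 2) * V + 16 * L + 10 * V + 13
  (12290 * (2 * X + 1) + 100 * X + 100) + 3 +
    ((X * (141 * X + 163) + 9 * X + 8) + 4 * trialC + (24 * L + 26))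

/-- The step-bound polynomial evaluates to the step bound. [folklore] -/
theorem costPoly_eval (s : ℕ) : costPoly.eval s = progCost s := by
  simp [costPoly, progCost, parseCost, kernelCost, setupCost, trialCost, levelCost, mulCost]

/-- **The block machine runs in polynomial time: `blockFn ∈ FP`** (`Com.mem_FP`, `StackPrograms.lean`).
[cite: AroraBarak2009, §1.3 (polynomial time on Turing machines; robustness)] -/
theorem blockFn_mem_FP : blockFn ∈ FP :=
  Com.mem_FP prog (o .inp) (o .RES) costPoly blockFn fun z => by
    obtain ⟨Rf, h, hout⟩ := runs_prog z
    exact ⟨Rf, Or.inl (by rw [costPoly_eval]; exact h), hout⟩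

/-! ### The residues are the modular powers -/

/-- The exponent accumulated by one trial over `k` levels of `m` control bits each:
`∑_{l<k} 2^l · #{ones in block l}` (Horner form). [cite: Shor1997, §3 p.9] -/
def levelExp (m : ℕ) : ℕ → List Bool → ℕ
  | 0, _ => 0
  | k + 1, S => (S.take m).count true + 2 * levelExp m k (S.drop m)

/-- **The bit loop multiplies by `p` once per set bit.** [folklore] -/
theorem bitLoop_eq {n p : ℕ} (hn : 0 < n) : ∀ (m r : ℕ) (S : List Bool), r < n →
    bitLoop n p r m S = (r * p ^ ((S.take m).count true) % n, S.drop m)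
  | 0, r, S, hr => by simp [bitLoop, Nat.mod_eq_of_lt hr]
  | m + 1, r, [], hr => by simp [bitLoop, Nat.mod_eq_of_lt hr]
  | m + 1, r, b :: S, hr => by
    rw [bitLoop, bitLoop_eq hn m _ S (by cases b <;> simp [Nat.mod_lt _ hn, hr])]
    cases b
    · simp
    · simp only [if_true, List.take_succ_cons, List.count_cons_self, List.drop_succ_cons, pow_succ]
      congr 1
      rw [Nat.mod_mul_mod]
      ring_nf

/-- **The level loop computes `p^{2^k}` and `r · p^{levelExp}` modulo `n`.** [cite: CLRS2009, §31.6] -/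
theorem levelLoop_eq {n m : ℕ} (hn : 1 < n) : ∀ (k p r : ℕ) (S : List Bool), p < n → r < n →
    levelLoop n m p r k S = (p ^ (2 ^ k) % n, r * p ^ (levelExp m k S) % n, S.drop (k * m))
  | 0, p, r, S, hp, hr => by simp [levelLoop, levelExp, Nat.mod_eq_of_lt hp, Nat.mod_eq_of_lt hr]
  | k + 1, p, r, S, hp, hr => by
    have hn0 : 0 < n := by omega
    rw [levelLoop, bitLoop_eq hn0 m r S hr, levelLoop_eq hn k _ _ _ (Nat.mod_lt _ hn0) (Nat.mod_lt _ hn0),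
      levelExp]
    simp only
    refine Prod.ext ?_ (Prod.ext ?_ ?_)
    · simp only
      rw [← Nat.pow_mod, ← pow_two, ← pow_mul, pow_succ]
      ring_nf
    · simp only
      rw [Nat.mul_mod, Nat.mod_mod, ← Nat.pow_mod, ← Nat.mul_mod, pow_add, pow_mul, mul_assoc, ← pow_two,
        ← pow_mul]
    · simp only
      rw [List.drop_drop, Nat.succ_mul, Nat.add_comm]

/-- **One trial computes `x^{levelExp} mod n`.** [cite: Shor1997, §3 p.9] -/
theorem trial_eq {x n : ℕ} (hn : 1 < n) (k m : ℕ) (S : List Bool) :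
    trial x n k m S = (x ^ levelExp m k S % n, S.drop (k * m)) := by
  have hn0 : 0 < n := by omega
  rw [trial, levelLoop_eq hn k _ _ S (Nat.mod_lt _ hn0) hn]
  simp [← Nat.pow_mod]

/-- **The residues of `j` consecutive trials.** [folklore] -/
theorem trials_eq {x n : ℕ} (hn : 1 < n) (k m : ℕ) : ∀ (j : ℕ) (S : List Bool),
    trials x n k m j S = (List.range j).map fun t => x ^ levelExp m k (S.drop (t * (k * m))) % n
  | 0, S => rfl
  | j + 1, S => by
    rw [trials, trial_eq hn, trials_eq hn k m j, List.range_succ_eq_map, List.map_cons, List.map_map]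
    simp only [zero_mul, List.drop_zero, List.cons.injEq, true_and]
    refine List.map_congr_left fun t _ => ?_
    simp only [Function.comp_apply, List.drop_drop]
    rw [Nat.succ_mul, Nat.add_comm]

/-! ### The well-formed inputs -/

/-- **The block machine on a well-formed input**: on `⟨x, n⟩ ++ y ++ 0 1^ℓ` with
`ℓ = |⟨x, n⟩|` and `1 < n`, the output is the coded list of the numerals of the four residues
`x ^ levelExp (2B) (2ℓ+1) (y after t trials) mod n`. [cite: Shor1997, §3 (pp. 8–10)] -/
theorem blockFn_wellFormed (x n : ℕ) (hn : 1 < n) (y : List Bool) :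
    blockFn (encodeOrderInstance x n ++ y ++ (false :: ones (encodeOrderInstance x n).length)) =
      encList ((List.range 4).map fun t => encodeNat
        (x ^ levelExp (12288 * (2 * (encodeOrderInstance x n).length + 1)) (2 * (encodeOrderInstance x n).length + 1)
          (y.drop (t * ((2 * (encodeOrderInstance x n).length + 1) *
            (12288 * (2 * (encodeOrderInstance x n).length + 1))))) % n)) := by
  set w := encodeOrderInstance x n with hw
  set z := w ++ y ++ (false :: ones w.length) with hz
  have hw' : w = boolPair (encodeNat x) (encodeNat n) := rfl
  have hell : ell z = w.length := ell_wf (w ++ y) _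
  have hpre : pre z = w ++ y := pre_wf (w ++ y) _
  have hwq : wq z = w := by rw [wq, hpre, hell]; simp
  have hys : ys z = y := by rw [ys, hpre, hell]; simp
  have hfst : fstq z = encodeNat x := by rw [fstq, hwq, hw', boolUnpair_boolPair]
  have hsnd : sndq z = encodeNat n := by rw [sndq, hwq, hw', boolUnpair_boolPair]
  have hlv : lv z = 2 * w.length + 1 := by rw [lv, hell]
  have hbb : bb z = 12288 * (2 * w.length + 1) := by rw [bb, hlv]
  have hvalid : valid z = true := by
    rw [valid, hwq, hsnd, hw', wellPaired_boolPair, canonTop_reverse]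
    simp only [isCanonicalNum_encodeNat, decide_true, Bool.and_self, Bool.true_and, decide_eq_true_eq]
    exact (one_lt_bitsToNat_iff (isCanonicalNum_encodeNat n)).1 (by simpa using hn)
  rw [blockFn, if_pos hvalid, results, hfst, hsnd, bitsToNat_encodeNat, bitsToNat_encodeNat, trials_eq hn,
    hys, hlv, hbb, List.map_map]
  rfl

end ModExpBlock

end Literature.Computability.Cryptography

end
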